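import Literature.NumberTheory.EllipticCurves.Rank1Residual.PrintShapeTorsion
import Literature.NumberTheory.EllipticCurves.Rank1Residual.Predicates
import Literature.NumberTheory.EllipticCurves.LeadingTermPPartRankLeOne
import Literature.NumberTheory.EllipticCurves.NonEisensteinPrimeOfSurjective
import HarnessLib

/-!
# `BSD(E,p)` in analytic rank `≤ 1` at a good ordinary `p ≥ 5` with `ρ̄_{E,p}` surjective — the Beilinson–Flach-free route (Skinner–Urban 2014 + W. Zhang 2014)

Glue theorems only (no definition, no named fact): the route of record `(P1′)` of the bsd-percentage
bundle's `PERCENT-FULL.md` §(ii).2 (cell `pub-bsdpct`; referee A RULING R151.2, "T-PF6 PASS", which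
names THIS theorem `bsdp_of_S30_of_WZhang2014` as owed), assembled from two refereed theorems already in
the tree as named facts, Gross–Zagier–Kolyvagin and modularity:

* rank `0`: the tree's **bsd.S30** `padicValRat_bsd_rank_zero` = Skinner–Urban, Invent. Math. 195 (2014)
  Thm. 2 (a) (good ordinary `p ≥ 3`; `E[p]` irreducible; `ρ̄_{E,p}` surjective; a multiplicative
  `ℓ ≠ p` with `ρ̄_{E,p}` ramified at `ℓ`, i.e. `p ∤ v_ℓ(Δ_min)`; `L(E,1) ≠ 0`) — `bsdp_rankZero_of_S30`;
* rank `1`: `WZhang2014_padicValRat_bsd_rank_one_ordinary` = W. Zhang, Camb. J. Math. 2 (2014) Thm. 1.6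
  with Thm. 1.4 (1)–(4) (good ordinary `p ≥ 5`, surjective, (2) "`ℓ ≡ ±1 (mod p)`, `ℓ ∥ N` ⇒ ramified at
  `ℓ`", (3) the `Ram` condition when `N` is not square-free) — `bsdp_rankOne_of_WZhang2014`;
* both: `bsdp_of_S30_of_WZhang2014` — at a good ordinary `p ≥ 5` with `ρ̄_{E,p}` surjective, Zhang's (2)
  (equivalently: `p ∉ Z*(E)`, the finite exceptional set of `PERCENT-FULL.md` row (ii-1)), and TWO
  distinct multiplicative primes `ℓ₁, ℓ₂` with `p ∤ v_{ℓ_i}(Δ_min)` (which supplies Skinner–Urban's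
  auxiliary prime and makes Zhang's (3) automatic: `#Ram ≥ 2`; this is the density-one condition (F3)
  of the bundle — Bhargava–Skinner–Zhang, arXiv:1407.1826v2, Lemma 20, verbatim: "Let `p` be any prime.
  Then, when ordered by height, a density of 100% of elliptic curves `E` over `ℚ` possess the following
  two properties: `E[p]` is an irreducible `Gal(ℚ̄/ℚ)`-module; there exist at least two prime factors
  `ℓ ∥ N(E)`, `ℓ ≠ p`, such that `E[p]` is ramified at `ℓ`", whose PROOF exhibits the `p`-independent
  density-one set "two primes `5 ≤ ℓ₁, ℓ₂ ≤ L`" with `ord_{ℓ_i} Δ(A,B) = 1` (then `ℓ_i ∥ N` and `E[p]` is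
  ramified at `ℓ_i` for EVERY `p`, `p ∤ 1`) — the form used here), an elliptic curve of analytic rank
  `≤ 1` satisfies Miller's `BSD(E,p)` (`BSDp W p`).

The print shapes are turned into `BSDp` by the cell's bridges `Rank1Residual.bsdp_of_pPartRankZero` /
`bsdp_of_pPart` (torsion term carried, as printed by Skinner–Urban and Zhang — no irreducibility is
needed by the bridge; `L^{(r)}(E,1) ≠ 0` from modularity `hasEntireLFunction_rat`; `rank = r_an`,
`Ш` finite from `rank_eq_analyticRank_of_analyticRank_le_one`). Compare the sibling
`BurungaleCastellaSkinner2025.bsdp_of_cor131` (same conclusion from BCS 2025 Cor. 1.3.1, whose printed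
proof imports a preprint — census flag `BCS25-IMC-equiv@BSTW`; the present route uses none).
-/

noncomputable section

open scoped Classical

open WeierstrassCurve Literature.NumberTheory.EllipticCurves

namespace Literature.NumberTheory.EllipticCurves.Rank1Residual

variable (W : WeierstrassCurve ℚ) [W.IsElliptic] [W.IsGloballyMinimal] (p : ℕ) [Fact p.Prime]

omit [W.IsElliptic] [W.IsGloballyMinimal] in
/-- A multiplicative prime is not a good prime: if `E` has good reduction at `p` and multiplicative
reduction at `ℓ` then `ℓ ≠ p` (Silverman, *AEC* VII.5.1; Mathlib
`WeierstrassCurve.HasMultiplicativeReduction.not_hasGoodReduction`). [folklore] -/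
theorem ne_of_hasMultiplicativeReductionAtPrime_of_hasGoodReductionAtPrime
    (hgood : W.HasGoodReductionAtPrime p) (ℓ : ℕ) [Fact ℓ.Prime]
    (hmult : W.HasMultiplicativeReductionAtPrime ℓ) : ℓ ≠ p := by
  rintro rfl
  exact WeierstrassCurve.HasMultiplicativeReduction.not_hasGoodReduction (R := ℤ_[ℓ]) hmult hgood

/-- **Rank `0` (Skinner–Urban 2014, Thm. 2 (a) = bsd.S30) ⇒ `BSD(E,p)`.** At a good ordinary prime
`p ≥ 3` with `ρ̄_{E,p}` surjective and a multiplicative prime `ℓ ≠ p` at which `ρ̄_{E,p}` is ramified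
(`p ∤ v_ℓ(Δ_min)`), an elliptic curve with `ord_{s=1} L(E,s) = 0` satisfies Miller's `BSD(E,p)`:
`L(E,1) = L^{(0)}(E,1) ≠ 0` by modularity (`leadingLCoeff_ne_zero_holds`), irreducibility from
surjectivity, `Ш` finite by Gross–Zagier–Kolyvagin, and bsd.S30's print shape (torsion term included)
is the cell's `PPartRankZero`. [cite: SkinnerUrban2014, Thm. 2 (a) (p. 3)] [cite: Miller2011LMS, Def. 1.1] -/
theorem bsdp_rankZero_of_S30 (hS30 : padicValRat_bsd_rank_zero) (hmod : hasEntireLFunction_rat)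
    (hGZK : rank_eq_analyticRank_of_analyticRank_le_one)
    (hp : 3 ≤ p) (hord : GoodOrd W p) (hsurj : Surj W p)
    (haux : ∃ ℓ : ℕ, ∃ _ : Fact ℓ.Prime, ℓ ≠ p ∧ W.HasMultiplicativeReductionAtPrime ℓ ∧
      ¬ p ∣ padicValInt ℓ W.minimalDiscriminantInt)
    (hr : W.analyticRank = 0) : BSDp W p := by
  have hirr : W.HasIrreducibleModPGaloisRep p :=
    hasIrreducibleModPGaloisRep_of_hasSurjectiveModNGaloisRep W p hsurj
  have hfin : Finite W.sha := (hGZK W (by omega)).2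
  have hL : W.entireLFunction 1 ≠ 0 := by
    rw [← W.leadingLCoeff_eq_of_analyticRank_eq_zero hr]
    exact W.leadingLCoeff_ne_zero_holds (hmod W)
  exact bsdp_of_pPartRankZero W p hmod hGZK hr
    (hS30 W p hp hord.1 hord.2 hirr haux hL hsurj hfin)

/-- **Rank `1` (W. Zhang 2014, Thm. 1.6) ⇒ `BSD(E,p)`.** At a good ordinary prime `p ≥ 5` with
`ρ̄_{E,p}` surjective and Zhang's hypotheses (2) ("`ℓ ≡ ±1 (mod p)`, `ℓ ∥ N` ⇒ `ρ̄_{E,p}` ramified at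
`ℓ`") and (3) (if `N` is not square-free: `Ram ≠ ∅`, and `#Ram = 1 ⇒` an even number of
multiplicative primes), an elliptic curve with `ord_{s=1} L(E,s) = 1` satisfies Miller's `BSD(E,p)`:
Zhang's identity with `Reg = ⟨y,y⟩/[E(ℚ):ℤy]² = W.regulator/#E(ℚ)²_tors` is the cell's general print
shape `PPart` (torsion term carried), and `bsdp_of_pPart` applies (modularity for `L'(E,1) ≠ 0`,
Gross–Zagier–Kolyvagin for `rank = 1` and `Ш` finite).
[cite: WZhang2014, Thm. 1.6 (p. 199), Thm. 1.4 (p. 197)] [cite: Miller2011LMS, Def. 1.1] -/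
theorem bsdp_rankOne_of_WZhang2014 (hZ : WZhang2014_padicValRat_bsd_rank_one_ordinary)
    (hmod : hasEntireLFunction_rat) (hGZK : rank_eq_analyticRank_of_analyticRank_le_one)
    (hp : 5 ≤ p) (hord : GoodOrd W p) (hsurj : Surj W p)
    (h2 : ∀ (ℓ : ℕ) [Fact ℓ.Prime], W.HasMultiplicativeReductionAtPrime ℓ →
      (p ∣ ℓ - 1 ∨ p ∣ ℓ + 1) → ¬ p ∣ padicValInt ℓ W.minimalDiscriminantInt)
    (h3 : ¬ W.IsSemistable ℤ →
      (∃ ℓ : ℕ, ∃ _ : Fact ℓ.Prime, W.HasMultiplicativeReductionAtPrime ℓ ∧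
          ¬ p ∣ padicValInt ℓ W.minimalDiscriminantInt) ∧
        (Set.ncard {ℓ : ℕ | ∃ _ : Fact ℓ.Prime, W.HasMultiplicativeReductionAtPrime ℓ ∧
            ¬ p ∣ padicValInt ℓ W.minimalDiscriminantInt} = 1 →
          Even (Set.ncard {ℓ : ℕ | ∃ _ : Fact ℓ.Prime, W.HasMultiplicativeReductionAtPrime ℓ})))
    (hr : W.analyticRank = 1) : BSDp W p := by
  have hfin : Finite W.sha := (hGZK W (by omega)).2
  obtain ⟨q, hq, hv⟩ := hZ W p hp hord.1 hord.2 hsurj h2 h3 hr hfin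
  refine bsdp_of_pPart W p hmod hGZK (by omega) ⟨q, ?_, hv⟩
  rw [← hq]
  push_cast
  ring

/-- **The Beilinson–Flach-free route (P1′) of `PERCENT-FULL.md` §(ii).2: `BSD(E,p)` in analytic rank
`≤ 1` at a good ordinary `p ≥ 5` with surjective `ρ̄_{E,p}`, `p ∉ Z*(E)`, and two ramified
multiplicative primes.** Hypotheses: `p ≥ 5` good ordinary (`GoodOrd`); `ρ̄_{E,p}` surjective
(`Surj`); Zhang's (2) — every multiplicative `ℓ ≡ ±1 (mod p)` has `p ∤ v_ℓ(Δ_min)` — i.e. `p` is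
outside the finite set `Z*(E) = {p : ∃ ℓ ∥ N, ℓ ≡ ±1 (mod p), p ∣ ord_ℓ Δ}`; and two DISTINCT
multiplicative primes `ℓ₁, ℓ₂` with `p ∤ v_{ℓ_i}(Δ_min)` (`ρ̄_{E,p}` ramified at both), which gives
Skinner–Urban's auxiliary prime (rank `0`) and Zhang's (3) (`#Ram ≥ 2`, rank `1`). Then
`ord_{s=1} L(E,s) ≤ 1 ⇒ BSD(E,p)`. Inputs: bsd.S30 (Skinner–Urban 2014 Thm. 2 (a)), W. Zhang 2014
Thm. 1.6, modularity, Gross–Zagier–Kolyvagin — all refereed; no Beilinson–Flach element (contrast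
`BurungaleCastellaSkinner2025.bsdp_of_cor131`). This is the glue theorem named by referee A's ruling
R151.2 of the bsd-percentage cell.
[cite: SkinnerUrban2014, Thm. 2 (a) (p. 3)] [cite: WZhang2014, Thm. 1.6 (p. 199), Thm. 1.4 (p. 197)] -/
theorem bsdp_of_S30_of_WZhang2014 (hS30 : padicValRat_bsd_rank_zero)
    (hZ : WZhang2014_padicValRat_bsd_rank_one_ordinary) (hmod : hasEntireLFunction_rat)
    (hGZK : rank_eq_analyticRank_of_analyticRank_le_one)
    (hp : 5 ≤ p) (hord : GoodOrd W p) (hsurj : Surj W p)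
    (hZstar : ∀ (ℓ : ℕ) [Fact ℓ.Prime], W.HasMultiplicativeReductionAtPrime ℓ →
      (p ∣ ℓ - 1 ∨ p ∣ ℓ + 1) → ¬ p ∣ padicValInt ℓ W.minimalDiscriminantInt)
    (htwo : ∃ ℓ₁ ℓ₂ : ℕ, ∃ _ : Fact ℓ₁.Prime, ∃ _ : Fact ℓ₂.Prime, ℓ₁ ≠ ℓ₂ ∧
      W.HasMultiplicativeReductionAtPrime ℓ₁ ∧ ¬ p ∣ padicValInt ℓ₁ W.minimalDiscriminantInt ∧
      W.HasMultiplicativeReductionAtPrime ℓ₂ ∧ ¬ p ∣ padicValInt ℓ₂ W.minimalDiscriminantInt)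
    (hr : W.analyticRank ≤ 1) : BSDp W p := by
  obtain ⟨ℓ₁, ℓ₂, i₁, i₂, hne, hm₁, hv₁, hm₂, hv₂⟩ := htwo
  rcases Nat.lt_or_ge W.analyticRank 1 with h0 | h1
  · -- analytic rank 0: Skinner–Urban
    have hr0 : W.analyticRank = 0 := by omega
    refine bsdp_rankZero_of_S30 W p hS30 hmod hGZK (by omega) hord hsurj ?_ hr0
    exact ⟨ℓ₁, i₁, ne_of_hasMultiplicativeReductionAtPrime_of_hasGoodReductionAtPrime W p hord.1 ℓ₁ hm₁,
      hm₁, hv₁⟩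
  · -- analytic rank 1: W. Zhang
    have hr1 : W.analyticRank = 1 := by omega
    refine bsdp_rankOne_of_WZhang2014 W p hZ hmod hGZK hp hord hsurj hZstar ?_ hr1
    intro _
    refine ⟨⟨ℓ₁, i₁, hm₁, hv₁⟩, fun hcard ↦ ?_⟩
    -- `#Ram = 1` is impossible: `ℓ₁ ≠ ℓ₂` both lie in `Ram`
    exfalso
    obtain ⟨a, ha⟩ := Set.ncard_eq_one.mp hcard
    have h₁ : ℓ₁ ∈ ({a} : Set ℕ) := ha ▸ (show ℓ₁ ∈ {ℓ : ℕ | ∃ _ : Fact ℓ.Prime,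
      W.HasMultiplicativeReductionAtPrime ℓ ∧ ¬ p ∣ padicValInt ℓ W.minimalDiscriminantInt} from
      ⟨i₁, hm₁, hv₁⟩)
    have h₂ : ℓ₂ ∈ ({a} : Set ℕ) := ha ▸ (show ℓ₂ ∈ {ℓ : ℕ | ∃ _ : Fact ℓ.Prime,
      W.HasMultiplicativeReductionAtPrime ℓ ∧ ¬ p ∣ padicValInt ℓ W.minimalDiscriminantInt} from
      ⟨i₂, hm₂, hv₂⟩)
    rw [Set.mem_singleton_iff] at h₁ h₂
    exact hne (h₁.trans h₂.symm)

end Literature.NumberTheory.EllipticCurves.Rank1Residual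

end
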